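import Summits.PneNP.PneNP.Theses.ExpanderLinearGenerators
import Summits.PneNP.PneNP.Theorems.ExpanderLinearGeneratorsPolyCalcDegree
import Summits.PneNP.PneNP.Theorems.ExpanderLinearGeneratorsLinearGeneratorModPFregeHardMod2Cert
import Summits.PneNP.PneNP.Theorems.ExpanderLinearGeneratorsLinearGeneratorDepthFregeHardDepthFloor
import Literature.Computability.Complexity.NullstellensatzPC
import Mathlib.Data.ZMod.Basic
import HarnessLib

/-!
# The polynomial calculus rung under `LinearGeneratorModPFregeHard` (item stmt-PneNP-11444)

Route `PneNP/ExpanderLinearGenerators`, crux `LinearGeneratorModPFregeHard` (rung 4, the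
`AC⁰[p]`-Frege rung: for odd primes `p`, depth-`d` `textbookFrege(MOD_p)` refutations of the
XOR-CNF `sumEncoding 1 E` of an `ℓ`-sparse `(n^(1-δ), 3ℓ/4)`-boundary-expanding unsolvable
system `E` over `𝔽₂` have size `2^(n^ε)` — an instance of Krajíček's open Problem 15.6.1).
By Buss–Impagliazzo–Krajíček–Pudlák–Razborov–Sgall (1997) an `F_d(MOD_p)` refutation of size `s`
yields a Nullstellensatz / polynomial calculus refutation over `𝔽_p` of degree `(log s)^{O(1)}`
WITH extension polynomials; the route's foreseen split of the crux goes through a degree lower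
bound for that algebraic system.  WITHOUT extension polynomials the degree lower bound is known,
and this file lands it for the item's family — the POLYNOMIAL CALCULUS RUNG, the analogue for
rung 4 of the resolution rung `ExpanderXorResWidth` under rungs 2/3:

* `not_refutableInDegree_sumEncoding` — over every field `K` with `2 ≠ 0`, for every system
  `E : Fin m → LinEqMod 2 n` whose supports form an `(r, c)`-boundary expander (`c > 0`,
  `r ≥ 2`), the clause polynomials of `sumEncoding 1 E` (translation (6.0.1)) have no
  PC/`K`-refutation of degree `≤ c r / 4` (from the abstract theorem of `…PolyCalcDegree.lean`,
  Ben-Sasson–Impagliazzo / Alekhnovich–Razborov; the bookkeeping here identifies each clause of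
  the canonical CNF of row `i` with the XOR constraint `(supp Eᵢ, (-1)^{bᵢ})`).
* `not_hasNSRefutationOfDegree_sumEncoding` — the same for Nullstellensatz refutations (NS is a
  subsystem of PC, `NullstellensatzPC.lean`): no family of axioms drawn from the clause polynomials
  and the Boolean axioms has an NS refutation with products of degree `≤ c r / 4` — NS over `𝔽_p`
  being the target system of the BIKPRS translation, minus its extension polynomials.
* `linearGeneratorModPFregeHard_polyCalc_rung` — in the item's regime: for every odd prime `p`,
  `ℓ ≥ 1`, `δ < 1` and `n ≥ ⌈2^{1/(1-δ)}⌉`, every `(n^(1-δ), 3ℓ/4)`-boundary-expanding system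
  on `n` variables has no PC/`𝔽_p`-refutation of its XOR-CNF of degree `≤ (3ℓ/16)·n^(1-δ)`
  (sparsity and unsolvability are not needed).  So on the item's instances the algebraic
  system beneath `F_d(MOD_p)` needs degree `n^{1-δ-o(1)}`; what separates this from the crux
  is exactly the extension polynomials of the BIKPRS translation.

References: E. Ben-Sasson, R. Impagliazzo, Comput. Complexity 19 (2010) §4
[BenSassonImpagliazzo2010]; M. Alekhnovich, A. Razborov, Proc. Steklov Inst. 242 (2003) 18–35;
S. Buss, D. Grigoriev, R. Impagliazzo, T. Pitassi, JCSS 62 (2001) §4; S. Buss, R. Impagliazzo,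
J. Krajíček, P. Pudlák, A. Razborov, J. Sgall, Comput. Complexity 6 (1996/97)
[BussImpagliazzoKrajicekPudlakRazborovSgall1997]; J. Krajíček, *Proof Complexity* (2019) §6.2,
§15.6, §16.1 [KrajicekProofComplexity2019].
-/

noncomputable section

set_option linter.dupNamespace false -- `Summit.PneNP.PneNP.…`: summit = sub-problem (D-0017)

namespace Summit.PneNP.PneNP.Theorems.PolyCalc

open Finset MvPolynomial Literature.Computability.Complexity Literature.Computability.MetaComplexity
open Summit.PneNP.PneNP.Theorems.ModTwo
open scoped symmDiff

variable {K : Type*} [Field K] {n m : ℕ}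

/-! ### The XOR constraints of a system over `𝔽₂`: scope vectors and signs -/

/-- The scope vector of row `i`: the indicator of its support (as naturals). [folklore] -/
def rowVec (E : Fin m → LinEqMod 2 n) (i : Fin m) : ParityVec :=
  indVec ((E i).supp.map Fin.valEmbedding)

variable (K) in
/-- The `±1` right-hand side of row `i` in `K`: `(-1)^{bᵢ}`. [Buss–Grigoriev–Impagliazzo–Pitassi
2001, §4] [folklore] -/
def rowSign (E : Fin m → LinEqMod 2 n) (i : Fin m) : K :=
  if (E i).2 = 0 then 1 else -1

/-- `rowSign = ±1`. [folklore] -/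
theorem rowSign_mul_self (E : Fin m → LinEqMod 2 n) (i : Fin m) :
    rowSign K E i * rowSign K E i = 1 := by
  unfold rowSign; split <;> simp

/-! ### The clauses of `equationCNF 1 e` -/

/-- **Shape of the clauses.** Every clause of `equationCNF 1 e` is the sorted support `V` of `e`
signed against a wrong-parity sub-list `S` of `V`: `C = V.map (v ↦ (v, v ∉ S))`.
[Beck 2017, Def. 5.6] [folklore] -/
theorem exists_of_mem_equationCNF_one {e : LinEqMod 2 n} {C : Clause ℕ}
    (hC : C ∈ equationCNF 1 e) :
    ∃ S : List ℕ, S.Sublist ((e.supp.map Fin.valEmbedding).sort (· ≤ ·)) ∧ eqPred 1 e S = false ∧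
      C = ((e.supp.map Fin.valEmbedding).sort (· ≤ ·)).map fun v => (v, decide (v ∉ S)) := by
  rw [equationCNF, canonicalCNF, eqVars_one] at hC
  obtain ⟨S, hS, rfl⟩ := List.mem_map.1 hC
  obtain ⟨hsub, hP⟩ := List.mem_filter.1 hS
  exact ⟨S, List.mem_sublists.1 hsub, by simpa using hP, rfl⟩

/-- The product of `±1` signs along a list is `(-1)^{#(members of S)}`. [folklore] -/
theorem prod_map_ite_mem (S : List ℕ) :
    ∀ V : List ℕ, (V.map fun v => if v ∈ S then (-1 : K) else 1).prod =
      (-1) ^ (V.filter fun v => decide (v ∈ S)).length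
  | [] => by simp
  | a :: V => by
    rw [List.map_cons, List.prod_cons, prod_map_ite_mem S V, List.filter_cons]
    by_cases h : a ∈ S <;> simp [h, pow_succ]

/-- **A wrong-parity sub-list has length of parity `≠ b`.** [Beck 2017, Def. 5.6] [folklore] -/
theorem length_parity_of_eqPred_false {e : LinEqMod 2 n} {S : List ℕ}
    (hS : S.Sublist ((e.supp.map Fin.valEmbedding).sort (· ≤ ·))) (hP : eqPred 1 e S = false) :
    ((S.length : ℕ) : ZMod 2) ≠ e.2 := by
  set V := (e.supp.map Fin.valEmbedding).sort (· ≤ ·) with hV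
  have hVnd : V.Nodup := Finset.sort_nodup _ _
  intro hlen
  have hP' : ¬ (eqPred 1 e S = true) := by rw [hP]; exact Bool.false_ne_true
  apply hP'
  rw [eqPred_one_iff, ← hlen, ← filter_mem_eq_of_sublist hS hVnd,
    length_filter_cast_eq_sum (fun v => decide (v ∈ S)) V, hV, sum_sort_map, Finset.sum_map]
  refine Finset.sum_congr rfl fun j hj => ?_
  have hjV : (j : ℕ) ∈ (e.supp.map Fin.valEmbedding).sort (· ≤ ·) :=
    (mem_sort_supp_iff e).2 ⟨j, hj, rfl⟩
  by_cases h : (j : ℕ) ∈ S <;> simp [h, hjV]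

section Clause

variable {e : LinEqMod 2 n} {S : List ℕ}

/-- Length of a canonical clause: the size of the support. [folklore] -/
theorem length_canonClause :
    (((e.supp.map Fin.valEmbedding).sort (· ≤ ·)).map fun v => (v, decide (v ∉ S))).length =
      e.supp.card := by
  rw [List.length_map, Finset.length_sort, Finset.card_map]

/-- Scope vector of a canonical clause: the indicator of the support. [folklore] -/
theorem clauseVec_canonClause :
    clauseVec (((e.supp.map Fin.valEmbedding).sort (· ≤ ·)).map fun v => (v, decide (v ∉ S))) =
      indVec (e.supp.map Fin.valEmbedding) := by
  set V := (e.supp.map Fin.valEmbedding).sort (· ≤ ·) with hV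
  have hfst : (V.map fun v => (v, decide (v ∉ S))).map Prod.fst = V := by
    rw [List.map_map]
    conv_rhs => rw [← List.map_id V]
    rfl
  have hnd : ((V.map fun v => (v, decide (v ∉ S))).map Prod.fst).Nodup := by
    rw [hfst]; exact Finset.sort_nodup _ _
  rw [clauseVec_eq_indVec hnd, clauseScope, hfst, hV, Finset.sort_toFinset]

/-- Sign of a canonical clause: `(-1)^{b}` — a clause excluding a wrong-parity assignment of row
`e` carries the row's right-hand side. [Buss–Grigoriev–Impagliazzo–Pitassi 2001, §4 (Tseitin
clauses as parity axioms)] [folklore] -/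
theorem clauseSignK_canonClause (hS : S.Sublist ((e.supp.map Fin.valEmbedding).sort (· ≤ ·)))
    (hP : eqPred 1 e S = false) :
    clauseSignK K (((e.supp.map Fin.valEmbedding).sort (· ≤ ·)).map fun v => (v, decide (v ∉ S))) =
      if e.2 = 0 then 1 else -1 := by
  set V := (e.supp.map Fin.valEmbedding).sort (· ≤ ·) with hV
  set C := V.map fun v => (v, decide (v ∉ S)) with hCdef
  have hVnd : V.Nodup := Finset.sort_nodup _ _
  -- the product of the literal signs is `(-1)^{|S|}`
  have hprod : posSignK (K := K) C Finset.univ = (-1) ^ S.length := by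
    have h1 : posSignK (K := K) C Finset.univ = (C.map litSignK).prod := by
      rw [posSignK, ← List.prod_ofFn]
      congr 1
      exact List.ofFn_getElem_eq_map C litSignK
    have h2 : C.map (litSignK (K := K)) = V.map fun v => if v ∈ S then (-1 : K) else 1 := by
      rw [hCdef, List.map_map]
      refine List.map_congr_left fun v _ => ?_
      by_cases h : v ∈ S <;> simp [litSignK, h]
    rw [h1, h2, prod_map_ite_mem, filter_mem_eq_of_sublist hS hVnd]
  have hpar := length_parity_of_eqPred_false hS hP
  rw [clauseSignK, hprod]
  by_cases hb : e.2 = 0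
  · rw [if_pos hb]
    rw [hb, ZMod.natCast_ne_zero_iff_odd] at hpar
    rw [hpar.neg_one_pow, neg_neg]
  · rw [if_neg hb]
    have hb1 : e.2 = 1 := by
      revert hb; generalize e.2 = a; revert a; decide
    have heven : Even S.length := by
      rw [← ZMod.natCast_eq_zero_iff_even]
      revert hpar; rw [hb1]; generalize ((S.length : ℕ) : ZMod 2) = a; revert a; decide
    rw [heven.neg_one_pow]

end Clause

/-- **Every clause of `sumEncoding 1 E` sits on the row family**: it has the length of its
row's support, the row's scope vector and the row's sign.
[Beck 2017, Def. 5.6; Buss–Grigoriev–Impagliazzo–Pitassi 2001, §4] [folklore] -/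
theorem clause_sits_on_rows (E : Fin m → LinEqMod 2 n) {C : Clause ℕ} (hC : C ∈ sumEncoding 1 E) :
    ∃ i : Fin m, C.length = (E i).supp.card ∧ rowVec E i = clauseVec C ∧
      rowSign K E i = clauseSignK K C := by
  simp only [sumEncoding, List.mem_flatMap, List.mem_finRange, true_and] at hC
  obtain ⟨i, hi⟩ := hC
  obtain ⟨S, hS, hP, rfl⟩ := exists_of_mem_equationCNF_one hi
  exact ⟨i, length_canonClause, clauseVec_canonClause.symm, (clauseSignK_canonClause hS hP).symm⟩

/-! ### The polynomial calculus rung -/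

/-- **PC over characteristic `≠ 2` needs degree `> c r / 4` on the XOR-CNF of an
`(r, c)`-boundary expander.** For every field `K` with `2 ≠ 0` and every system
`E : Fin m → LinEqMod 2 n` whose supports form an `(r, c)`-boundary expander (`c > 0`, `r ≥ 2`),
the clause polynomials of `sumEncoding 1 E` have no PC/`K`-refutation of degree `≤ d` whenever
`d ≤ c r / 4`. [Ben-Sasson–Impagliazzo 2010, §4; Alekhnovich–Razborov 2003 (linear systems over
`𝔽₂`); Buss–Grigoriev–Impagliazzo–Pitassi 2001, §4–5] [folklore] -/
theorem not_refutableInDegree_sumEncoding (h2 : (2 : K) ≠ 0) (E : Fin m → LinEqMod 2 n)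
    {r c : ℝ} (hexp : IsBoundaryExpander (fun i => (E i).supp.map Fin.valEmbedding) r c)
    (hc : 0 < c) (hr : 2 ≤ r) {d : ℕ} (hd : (d : ℝ) ≤ c * r / 4) :
    ¬ PC.RefutableInDegree (cnfPolys K (sumEncoding 1 E)) d := by
  classical
  have hvec : VecExpands (rowVec E) r c := vecExpands_of_isBoundaryExpander hexp
  have hd' : ((2 * d : ℕ) : ℝ) ≤ c * r / 2 := by push_cast; linarith
  refine not_refutableInDegree_cnfPolys (g := rowVec E) (b := rowSign K E) h2 hvec hc hr hd'
    (rowSign_mul_self E) fun C hC => ?_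
  obtain ⟨i, hlen, hgi, hbi⟩ := clause_sits_on_rows (K := K) E hC
  refine ⟨?_, i, hgi, hbi⟩
  -- nonempty: expansion at the single row `i`
  have h1 := hvec {i} (by rw [Finset.card_singleton, Nat.cast_one]; linarith)
  rw [famVec_singleton, rowVec, support_indVec, Finset.card_map, Finset.card_singleton,
    Nat.cast_one, mul_one] at h1
  have : (0 : ℝ) < (E i).supp.card := hc.trans_le h1
  rw [hlen]
  exact_mod_cast this

/-- **Nullstellensatz form.** Under the same hypotheses, no family of axioms drawn from the clause
polynomials of `sumEncoding 1 E` and the Boolean axioms `x² - x` has a Nullstellensatz refutation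
`∑ g_a · A_a = 1` with all products of degree `≤ d`, `d ≤ c r / 4` (NS is a subsystem of PC).
[Buss–Grigoriev–Impagliazzo–Pitassi 2001, §4–5 (NS/PC over characteristic `≠ 2`);
Krajíček 2019, §6.2 (NS ⊆ PC)] [folklore] -/
theorem not_hasNSRefutationOfDegree_sumEncoding (h2 : (2 : K) ≠ 0) (E : Fin m → LinEqMod 2 n)
    {r c : ℝ} (hexp : IsBoundaryExpander (fun i => (E i).supp.map Fin.valEmbedding) r c)
    (hc : 0 < c) (hr : 2 ≤ r) {d : ℕ} (hd : (d : ℝ) ≤ c * r / 4) {ι : Type*}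
    {𝒜 : ι → MvPolynomial ℕ K}
    (h𝒜 : ∀ a, 𝒜 a ∈ cnfPolys K (sumEncoding 1 E) ∪
      Set.range fun j : ℕ => (X j ^ 2 - X j : MvPolynomial ℕ K)) :
    ¬ HasNSRefutationOfDegree 𝒜 d := fun h =>
  not_refutableInDegree_sumEncoding h2 E hexp hc hr hd
    (PC.refutableInDegree_of_hasNSRefutationOfDegree h h𝒜)

/-- `2 ≠ 0` in `𝔽_p` for a prime `p ≠ 2`. [folklore] -/
theorem two_ne_zero_zmod {p : ℕ} (hp : p.Prime) (hp2 : p ≠ 2) : (2 : ZMod p) ≠ 0 := by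
  intro h
  have h' : ((2 : ℕ) : ZMod p) = 0 := by exact_mod_cast h
  rw [ZMod.natCast_eq_zero_iff] at h'
  exact hp2 ((Nat.prime_dvd_prime_iff_eq hp Nat.prime_two).1 h')

open Summit.PneNP.PneNP.Theses.ExpanderLinearGenerators in
/-- **The polynomial calculus rung of `LinearGeneratorModPFregeHard`.** For every odd prime
`p`, every locality `ℓ ≥ 1` and every `δ < 1` there is `N` (namely `⌈2^{1/(1-δ)}⌉`) such that
for `n ≥ N`, every system `E : Fin m → LinEqMod 2 n` whose supports form an
`(n^(1-δ), 3/4·ℓ)`-boundary expander — the expansion hypothesis of the item — admits no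
PC/`𝔽_p`-refutation of the clause polynomials of `sumEncoding 1 E` of degree
`≤ (3ℓ/16) · n^(1-δ)`.  (Sparsity and unsolvability, the item's other hypotheses, are not
needed.)  The algebraic system beneath `F_d(MOD_p)` thus needs degree `n^{1-δ}` up to constants
on the item's instances; the crux asks the same of `F_d(MOD_p)` size on a `2^{n^ε}` scale, and by
Buss et al. (1997) the gap between the two is the extension polynomials of their translation.
[Ben-Sasson–Impagliazzo 2010, §4; Alekhnovich–Razborov 2003 (linear systems over `𝔽₂`);
Buss–Impagliazzo–Krajíček–Pudlák–Razborov–Sgall 1997, Def. 1.1; Krajíček 2019, §15.6]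
[folklore] -/
theorem linearGeneratorModPFregeHard_polyCalc_rung (p : ℕ) [Fact p.Prime] (hp2 : p ≠ 2)
    (ℓ : ℕ) (δ : ℝ) (hℓ : 1 ≤ ℓ) (hδ : δ < 1) :
    ∃ N : ℕ, ∀ n : ℕ, N ≤ n → ∀ (m : ℕ) (E : Fin m → LinEqMod 2 n),
      IsBoundaryExpander (fun i => (E i).supp.map Fin.valEmbedding) ((n : ℝ) ^ (1 - δ))
        (3 / 4 * ℓ) →
      ∀ d : ℕ, (d : ℝ) ≤ 3 * ℓ / 16 * (n : ℝ) ^ (1 - δ) →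
        ¬ PC.RefutableInDegree (cnfPolys (ZMod p) (sumEncoding 1 E)) d := by
  refine ⟨⌈(2 : ℝ) ^ (1 / (1 - δ))⌉₊, fun n hn m E hexp d hd => ?_⟩
  have hr : (2 : ℝ) ≤ (n : ℝ) ^ (1 - δ) := two_le_rpow_of_ceil_le hδ hn
  have hℓ' : (1 : ℝ) ≤ ℓ := by exact_mod_cast hℓ
  refine not_refutableInDegree_sumEncoding (two_ne_zero_zmod (Fact.out) hp2) E hexp
    (by positivity) hr ?_
  linarith

end Summit.PneNP.PneNP.Theorems.PolyCalc
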